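import Summits.ResolutionOfSingularities.ResolutionOfSingularities.Theorems.RisoStrataRisoCentresResolveCurveStep
import Summits.ResolutionOfSingularities.ResolutionOfSingularities.Theorems.RisoStrataRisoCentresResolveCurveReach
import Summits.ResolutionOfSingularities.ResolutionOfSingularities.Theorems.RisoStrataRisoCentresResolveCurveAssembly

/-!
# Route RisoStrata — crux `RisoCentresResolve` (stmt-ResolutionOfSingularities-18546), line `Sketch`:
# riso local uniformization for points and CURVES (`Algebra.trdeg k K ≤ 1`)

The core of line `Sketch` — riso local uniformization along some word (Monreal, arXiv:2606.12554,
Question 1.6 in characteristic `p`, local form; `Theorems/RisoStrataRisoCentresResolveReduction.lean`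
shows it is EQUIVALENT to the crux) — holds for every projective presentation `K = k(hᵢ/hⱼ)` of
transcendence degree `≤ 1` over the algebraically closed ground field `k`, along the constant top
word `w ≡ N` (every letter `d ≥ N` blows up the whole reduced singular locus,
`hidden_cut_of_le`). Proof = the three landed curve stubs of skeleton v4/v5
(`Cruxes/RisoCentresResolve/Lines/Sketch.lean`): while the centre of a non-trivial valuation ring
`O` on the current one-dimensional chart is singular, the riso step localised at the centre of `O`
is the quadratic transform of the local ring along `O` (`stub_rcrCurveStep`); quadratic sequences
of local rings of affine curves along `O` reach `O`, a discrete valuation ring — E. Noether's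
finiteness of the normalization, Krull–Akizuki, Herrmann–Ikeda–Orbanz (30.2) (`stub_rcrCurveReach`);
hence some stage of an admissible chart path is regular (`stub_rcrCurveAssembly`). This is the
first rung (curves; Kollár 2007 Ch. 1 in riso dress) of the open core `stub_rcrLocalUnifHigher`
(transcendence degree `≥ 2`).
-/

noncomputable section

set_option linter.dupNamespace false -- mandated namespace of this single-conjunct summit

namespace Summit.ResolutionOfSingularities.ResolutionOfSingularities.Theorems

open Summit.ResolutionOfSingularities.ResolutionOfSingularities.Theses.RisoStrata
open Literature.AlgebraicGeometry.Resolution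

/-- **Riso local uniformization for points and curves.** For a prime `p`, an algebraically closed
field `k` of characteristic `p`, a field `K ⊇ k` with `Algebra.trdeg k K ≤ 1` and a projective
presentation `K = k(hᵢ/hⱼ)` by `N + 1` nonzero elements, there is a word `w` (the constant top
word `w ≡ N`) such that along every valuation ring `O ⊇ k` of `K` some chart `k[hᵢ/hⱼ] ⊆ O` and
some admissible chart path of the riso tower (centres = the rtd-cuts of the singular locus, here
always the whole reduced singular locus) reach, after finitely many steps, a regular local ring at
the centre of `O`. Composition of the landed stubs `stub_rcrCurveAssembly`, `stub_rcrCurveStep`,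
`stub_rcrCurveReach`. [folklore] -/
theorem rcr_localUnif_curve : ∀ p : ℕ, p.Prime → ∀ (k : Type) [Field k] [CharP k p] [IsAlgClosed k]
    (K : Type) [Field K] [Algebra k K] (N : ℕ) (h : Fin (N + 1) → K), (∀ i, h i ≠ 0) →
    IntermediateField.adjoin k
      (Set.range fun ij : Fin (N + 1) × Fin (N + 1) => h ij.1 * (h ij.2)⁻¹) = ⊤ →
    Algebra.trdeg k K ≤ 1 →
    ∃ w : ℕ → ℕ, ∀ O : ValuationSubring K, (∀ c : k, algebraMap k K c ∈ O) →
      ∃ (j : Fin (N + 1)) (x : ℕ → K) (t : ℕ), (∀ i, h i * (h j)⁻¹ ∈ O) ∧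
        (∀ s, s < t → risoValid (fun (B : Subalgebra k K) (m : Ideal ↥B) (d : ℕ) => ¬ ∃ (n : ℕ) (g : Fin n → ↥B),
        (∀ i, g i ∈ m) ∧ Algebra.adjoin k (Set.range fun i => (g i : K)) = B ∧
        ∃ W : Submodule k (Fin n → k), d + 1 ≤ Module.finrank k ↥W ∧
        ∃ φ : {α : ↥B →ₐ[k] HahnSeries ℚ k // ∀ b ∈ m, 0 < (α b).orderTop} → (Fin n → HahnSeries ℚ k),
          (∀ a b : {α : ↥B →ₐ[k] HahnSeries ℚ k // ∀ b ∈ m, 0 < (α b).orderTop}, a ≠ b →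
            ∃ j, ∀ i, (a.1 (g j) - b.1 (g j)).orderTop <
              ((φ a i - φ b i) - (a.1 (g i) - b.1 (g i))).orderTop) ∧
          (∀ a i, 0 < (φ a i).orderTop) ∧
          (∀ a, ∀ w : Fin n → HahnSeries ℚ k, (∀ i, 0 < (w i).orderTop) →
            w ∈ Submodule.span (HahnSeries ℚ k)
              ((fun u : Fin n → k => fun i => HahnSeries.C (u i)) '' (W : Set (Fin n → k))) →
              ∃ b, φ b = φ a + w)) O
          (risoStage (fun (B : Subalgebra k K) (m : Ideal ↥B) (d : ℕ) => ¬ ∃ (n : ℕ) (g : Fin n → ↥B),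
        (∀ i, g i ∈ m) ∧ Algebra.adjoin k (Set.range fun i => (g i : K)) = B ∧
        ∃ W : Submodule k (Fin n → k), d + 1 ≤ Module.finrank k ↥W ∧
        ∃ φ : {α : ↥B →ₐ[k] HahnSeries ℚ k // ∀ b ∈ m, 0 < (α b).orderTop} → (Fin n → HahnSeries ℚ k),
          (∀ a b : {α : ↥B →ₐ[k] HahnSeries ℚ k // ∀ b ∈ m, 0 < (α b).orderTop}, a ≠ b →
            ∃ j, ∀ i, (a.1 (g j) - b.1 (g j)).orderTop <
              ((φ a i - φ b i) - (a.1 (g i) - b.1 (g i))).orderTop) ∧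
          (∀ a i, 0 < (φ a i).orderTop) ∧
          (∀ a, ∀ w : Fin n → HahnSeries ℚ k, (∀ i, 0 < (w i).orderTop) →
            w ∈ Submodule.span (HahnSeries ℚ k)
              ((fun u : Fin n → k => fun i => HahnSeries.C (u i)) '' (W : Set (Fin n → k))) →
              ∃ b, φ b = φ a + w)) (Algebra.adjoin k (Set.range fun i => h i * (h j)⁻¹))
            ((List.range t).map w) x s) (w s) (x s)) ∧
        IsRegularLocalRing ↥(risoLoc O
          (risoStage (fun (B : Subalgebra k K) (m : Ideal ↥B) (d : ℕ) => ¬ ∃ (n : ℕ) (g : Fin n → ↥B),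
        (∀ i, g i ∈ m) ∧ Algebra.adjoin k (Set.range fun i => (g i : K)) = B ∧
        ∃ W : Submodule k (Fin n → k), d + 1 ≤ Module.finrank k ↥W ∧
        ∃ φ : {α : ↥B →ₐ[k] HahnSeries ℚ k // ∀ b ∈ m, 0 < (α b).orderTop} → (Fin n → HahnSeries ℚ k),
          (∀ a b : {α : ↥B →ₐ[k] HahnSeries ℚ k // ∀ b ∈ m, 0 < (α b).orderTop}, a ≠ b →
            ∃ j, ∀ i, (a.1 (g j) - b.1 (g j)).orderTop <
              ((φ a i - φ b i) - (a.1 (g i) - b.1 (g i))).orderTop) ∧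
          (∀ a i, 0 < (φ a i).orderTop) ∧
          (∀ a, ∀ w : Fin n → HahnSeries ℚ k, (∀ i, 0 < (w i).orderTop) →
            w ∈ Submodule.span (HahnSeries ℚ k)
              ((fun u : Fin n → k => fun i => HahnSeries.C (u i)) '' (W : Set (Fin n → k))) →
              ∃ b, φ b = φ a + w)) (Algebra.adjoin k (Set.range fun i => h i * (h j)⁻¹))
            ((List.range t).map w) x t)) :=
  stub_rcrCurveAssembly stub_rcrCurveStep stub_rcrCurveReach

end Summit.ResolutionOfSingularities.ResolutionOfSingularities.Theorems

end
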